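import Literature.NumberTheory.Automorphic.AutomorphicInductionUnitaryCharacterCubicResolventDescent
import Mathlib.FieldTheory.PolynomialGaloisGroup
import HarnessLib

/-!
# Non-normal cubic automorphic induction: the Galois closure and the quadratic resolvent of a
# non-normal cubic extension, and the sign-blind half stated over `E` alone (proofs)

Topic `NumberTheory/Automorphic`; namespace `Literature.NumberTheory.Automorphic`.  A proof file
(theorems only: no definition, no named fact, no instance) attached to the named fact
`Literature.NumberTheory.Automorphic.automorphicInduction_unitaryCharacter_cubic`
(`AutomorphicInductionUnitaryCharacterCubic`: Jacquet–Piatetski-Shapiro–Shalika 1979, §§13–14;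
Gelbart 1997, Thm. 5.3.1 with Remark 5.3.1 (e)), completing
`AutomorphicInductionUnitaryCharacterCubicResolventDescent`: there the sign-blind half of the
non-normal case was proved in an abstract sextic diagram `F ⊆ K ⊆ L ⊇ E ⊇ F`; here the diagram is
CONSTRUCTED from a non-normal cubic `E/F`, and the result is restated over `E/F` alone.

* **Galois closure of a non-normal cubic** (`F`, `E` fields, `E/F` separable of degree `3`, not
  normal, `α` a primitive element, `L` the splitting field of `minpoly F α`):
  `nonempty_algHom_splittingField_of_adjoin_eq_top` (`E ↪ L`), `finrank_splittingField_eq_six`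
  (`[L:F] = 6`: `Gal(L/F) ↪ 𝔖(roots)`, `3 ∣ [L:F] ∣ 6`, and `[L:F] = 3` would make `E ≅ L`
  normal), `exists_mul_ne_of_not_normal` (`Gal(L/F) ≅ S₃` is not abelian),
  `exists_intermediateField_resolvent` (a Galois quadratic `K ⊆ L` with `[L:K] = 3`: the fixed
  field of a subgroup of order `3`, normal of index `2` — the quadratic resolvent).
* **Places inert in the resolvent have splitting type `(1, 2)`** (the classical description of the
  decomposition of primes in an `S₃`-cubic: Frobenius a transposition):
  `HeightOneSpectrum.inertiaDeg_of_resolventInert_of_under_eq_one`,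
  `forall_mul_comm_of_resolventInert_of_forall_inertiaDeg_eq_one` (were an inert `v` totally split
  in `E`, `Gal(L/F) = ⟨s⟩⟨a⟩` would be abelian: `s` and `a⁻¹ s a` both lie in a decomposition group
  of order `2`), `exists_inertiaDeg_eq_one_and_eq_two_of_resolventInert`.
* `exists_cuspidal_cubic_of_not_normal` — **the sign-blind half over `E/F` alone**: for `E/F` a
  non-normal cubic extension of number fields and a Hecke character `θ` of `E` non-degenerate at
  infinitely many places of splitting type `≠ (1, 2)`, granting `automorphicInduction_cyclic_cuspidal`
  and `cuspidal_descent_cyclic` there is a cuspidal `π` on `GL₃(𝔸_F)` with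
  `det(X - t_{π,v}) = ∏_{w ∣ v} (X^{f(w|v)} - θ(ϖ_w))` at almost every `v` of splitting type
  `≠ (1, 2)` in `E` (totally split or inert: density `1/2`).

The complementary places (type `(1, 2)`, density `1/2`) are exactly where the cyclic theory pins
down only `t_{π,v}²` (`exists_cuspidal_cubic_resolvent` in the descent file) and where the fact's
identity IS the non-normal cubic lifting of Jacquet–Piatetski-Shapiro–Shalika (converse theorem for
`GL(3)`), which the tree does not have.  Net debt unchanged.

## References

* J. Arthur, L. Clozel, *Simple algebras, base change, and the advanced theory of the trace
  formula*, Ann. of Math. Stud. 120 (1989), Ch. 3, Thm. 4.2 (d), Thm. 6.2, Lemma 6.4.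
  [ArthurClozelAMS120]
* S. Gelbart, *Three lectures on the modularity of `ρ̄_{E,3}` and the Langlands reciprocity
  conjecture* (1997), Thm. 5.3.1, Remarks 5.3.1 (a), (e). [Gelbart1997]
* H. Jacquet, I. I. Piatetski-Shapiro, J. Shalika, *Automorphic forms on GL(3) II*, Ann. of Math.
  109 (1979), §§13–14. [JacquetPiatetskishapiroShalika1979II]
* J. Neukirch, *Algebraic Number Theory* (1999), Ch. I §9 (decomposition groups) and Ch. IV §5
  (Galois closure; background). [NeukirchANT1999]
-/

noncomputable section

open scoped NumberField Polynomial Classical Pointwise IntermediateField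
open NumberField IsDedekindDomain Polynomial Filter Literature.NumberTheory.Automorphic

namespace Literature.NumberTheory.Automorphic

/-! ### The Galois closure of a non-normal cubic extension is an `S₃`-sextic -/

section Closure

variable {F E : Type} [Field F] [Field E] [Algebra F E] [FiniteDimensional F E]
  [Algebra.IsSeparable F E]

omit [Algebra.IsSeparable F E] in
/-- The minimal polynomial of a primitive element of a cubic extension has degree `3`.
[folklore] -/
theorem natDegree_minpoly_eq_three_of_adjoin_eq_top (h3 : Module.finrank F E = 3) {α : E}
    (hα : F⟮α⟯ = ⊤) : (minpoly F α).natDegree = 3 := by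
  rw [← IntermediateField.adjoin.finrank (IsIntegral.of_finite F α), hα,
    IntermediateField.finrank_top', h3]

omit [Algebra.IsSeparable F E] in
/-- A finite extension generated by `α` embeds into the splitting field of the minimal polynomial
of `α`. [folklore] -/
theorem nonempty_algHom_splittingField_of_adjoin_eq_top {α : E} (hα : F⟮α⟯ = ⊤) :
    Nonempty (E →ₐ[F] (minpoly F α).SplittingField) :=
  IntermediateField.nonempty_algHom_of_adjoin_splits (S := {α})
    (fun s hs => by
      rw [Set.mem_singleton_iff] at hs
      subst hs
      exact ⟨IsIntegral.of_finite F s, SplittingField.splits (minpoly F s)⟩) hα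

/-- **The Galois closure of a non-normal cubic extension has degree `6`.**  For `E/F` separable
of degree `3`, not normal, and `α` a primitive element, the splitting field `L` of `minpoly F α`
(the Galois closure of `E/F`) has `[L:F] = 6`: `Gal(L/F)` embeds into the permutations of the
`3` roots, so `[L:F] ∣ 6`; `E ↪ L`, so `3 ∣ [L:F]`; and `[L:F] = 3` would make `E ≅ L` normal.
[folklore] -/
theorem finrank_splittingField_eq_six (h3 : Module.finrank F E = 3) (hE : ¬ Normal F E) {α : E}
    (hα : F⟮α⟯ = ⊤) : Module.finrank F (minpoly F α).SplittingField = 6 := by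
  set p := minpoly F α with hp
  have hint : IsIntegral F α := IsIntegral.of_finite F α
  have hsep : p.Separable := Algebra.IsSeparable.isSeparable F α
  have hdeg : p.natDegree = 3 := natDegree_minpoly_eq_three_of_adjoin_eq_top h3 hα
  haveI : Fact ((p.map (algebraMap F p.SplittingField)).Splits) := ⟨SplittingField.splits p⟩
  -- `[L:F] = #Gal ∣ 3! = 6`
  have hcard : Nat.card p.Gal = Module.finrank F p.SplittingField := Gal.card_of_separable hsep
  have hroots : Fintype.card (p.rootSet p.SplittingField) = 3 := by
    rw [card_rootSet_eq_natDegree hsep (SplittingField.splits p), hdeg]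
  have hdvd6 : Module.finrank F p.SplittingField ∣ 6 := by
    have h := Subgroup.card_dvd_of_injective _ (Gal.galActionHom_injective p p.SplittingField)
    rwa [hcard, Nat.card_eq_fintype_card, Fintype.card_perm, hroots] at h
  -- `3 ∣ [L:F]` through the embedding `E ↪ L`
  obtain ⟨φ⟩ := nonempty_algHom_splittingField_of_adjoin_eq_top hα
  letI : Algebra E p.SplittingField := φ.toRingHom.toAlgebra
  haveI : IsScalarTower F E p.SplittingField :=
    IsScalarTower.of_algebraMap_eq fun x => (φ.commutes x).symm
  have hdvd3 : 3 ∣ Module.finrank F p.SplittingField :=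
    ⟨Module.finrank E p.SplittingField, by rw [← h3, Module.finrank_mul_finrank]⟩
  -- not `3`: else `E ≅ L` is normal
  have hne3 : Module.finrank F p.SplittingField ≠ 3 := by
    intro h
    have hsurj : Function.Surjective φ.toLinearMap := by
      rw [← LinearMap.injective_iff_surjective_of_finrank_eq_finrank (h3.trans h.symm)]
      exact φ.toRingHom.injective
    exact hE (Normal.of_algEquiv (AlgEquiv.ofBijective φ ⟨φ.toRingHom.injective, hsurj⟩).symm)
  -- divisors of `6` that are multiples of `3`
  have hpos : 0 < Module.finrank F p.SplittingField := Module.finrank_pos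
  rcases hdvd3 with ⟨k, hk⟩
  rw [hk] at hdvd6 hne3 hpos ⊢
  have hk' : k ∣ 2 :=
    Nat.dvd_of_mul_dvd_mul_left (by norm_num : 0 < 3) (by rwa [show (6 : ℕ) = 3 * 2 from rfl] at hdvd6)
  rcases (Nat.dvd_prime Nat.prime_two).1 hk' with rfl | rfl
  · exact absurd rfl hne3
  · rfl

/-- **The Galois group of the Galois closure of a non-normal cubic extension is not abelian**
(it is all of `S₃`: it embeds into the permutations of the `3` roots and has order `6`).
[folklore] -/
theorem exists_mul_ne_of_not_normal (h3 : Module.finrank F E = 3) (hE : ¬ Normal F E) {α : E}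
    (hα : F⟮α⟯ = ⊤) :
    ∃ g h : (minpoly F α).SplittingField ≃ₐ[F] (minpoly F α).SplittingField, g * h ≠ h * g := by
  set p := minpoly F α with hp
  have hsep : p.Separable := Algebra.IsSeparable.isSeparable F α
  have hdeg : p.natDegree = 3 := natDegree_minpoly_eq_three_of_adjoin_eq_top h3 hα
  haveI : Fact ((p.map (algebraMap F p.SplittingField)).Splits) := ⟨SplittingField.splits p⟩
  have hroots : Fintype.card (p.rootSet p.SplittingField) = 3 := by
    rw [card_rootSet_eq_natDegree hsep (SplittingField.splits p), hdeg]
  have h6 := finrank_splittingField_eq_six h3 hE hα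
  -- `galActionHom : Gal → Perm (roots)` is a bijection
  have hbij : Function.Bijective (Gal.galActionHom p p.SplittingField) := by
    haveI : Fintype p.Gal := Fintype.ofFinite _
    refine (Fintype.bijective_iff_injective_and_card _).2
      ⟨Gal.galActionHom_injective p p.SplittingField, ?_⟩
    rw [← hp] at h6
    rw [Fintype.card_perm, hroots, ← Nat.card_eq_fintype_card, Gal.card_of_separable hsep, h6]
    rfl
  -- two non-commuting transpositions of the three roots
  obtain ⟨a, b, c, hab, hac, hbc⟩ := Fintype.two_lt_card_iff.1 (by rw [hroots]; norm_num)
  obtain ⟨g, hg⟩ := hbij.2 (Equiv.swap a b)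
  obtain ⟨h, hh⟩ := hbij.2 (Equiv.swap b c)
  refine ⟨g, h, fun hcomm => hbc ?_⟩
  have key : Equiv.swap a b * Equiv.swap b c = Equiv.swap b c * Equiv.swap a b := by
    rw [← hg, ← hh, ← MonoidHom.map_mul, ← MonoidHom.map_mul]
    exact congrArg _ hcomm
  -- evaluate at `a`: `b = swap a b (swap b c a) = swap b c (swap a b a) = c`
  have key' := Equiv.congr_fun key a
  simp only [Equiv.Perm.mul_apply, Equiv.swap_apply_left,
    Equiv.swap_apply_of_ne_of_ne hab hac] at key'
  exact key'

/-- **The quadratic resolvent**: the Galois closure `L` (degree `6`) of a non-normal cubic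
extension contains an intermediate field `K`, Galois and quadratic over `F`, with `[L:K] = 3`
(the fixed field of a subgroup of order `3` of `Gal(L/F)`, normal as it has index `2`).
[folklore] -/
theorem exists_intermediateField_resolvent {L : Type} [Field L] [Algebra F L] [IsGalois F L]
    [FiniteDimensional F L] (h6 : Module.finrank F L = 6) :
    ∃ K : IntermediateField F L, Module.finrank F K = 2 ∧ Module.finrank K L = 3 ∧
      IsGalois F K := by
  have hcardG : Nat.card (L ≃ₐ[F] L) = 6 := (IsGalois.card_aut_eq_finrank F L).trans h6
  haveI : Fact (Nat.Prime 3) := ⟨Nat.prime_three⟩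
  obtain ⟨σ, hσ⟩ := exists_prime_orderOf_dvd_card' (G := L ≃ₐ[F] L) 3
    (hcardG ▸ (by norm_num : 3 ∣ 6))
  set H : Subgroup (L ≃ₐ[F] L) := Subgroup.zpowers σ with hH
  have hcardH : Nat.card H = 3 := by rw [hH, Nat.card_zpowers, hσ]
  have hindex : H.index = 2 := by
    have := H.card_mul_index
    rw [hcardH, hcardG] at this
    omega
  haveI : H.Normal := Subgroup.normal_of_index_eq_two hindex
  refine ⟨IntermediateField.fixedField H, ?_, ?_, inferInstance⟩
  · have h1 := Module.finrank_mul_finrank F (IntermediateField.fixedField H) L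
    rw [IntermediateField.finrank_fixedField_eq_card, hcardH, h6] at h1
    omega
  · rw [IntermediateField.finrank_fixedField_eq_card, hcardH]

end Closure

/-! ### The sextic diagram at a place inert in `K`: splitting type `(1, 2)` in `E` -/

section Inert

variable {F K L E : Type} [Field F] [NumberField F] [Field K] [NumberField K]
  [Field L] [NumberField L] [Field E] [NumberField E]
  [Algebra F K] [Algebra K L] [Algebra F L] [IsScalarTower F K L]
  [Algebra F E] [Algebra E L] [IsScalarTower F E L]

omit [NumberField F] [NumberField K] [NumberField L] [NumberField E] [Algebra F E]
  [IsScalarTower F E L] in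
/-- `restrictScalars` commutes with integer powers. [folklore] -/
theorem AlgEquiv.restrictScalars_zpow' (a : L ≃ₐ[K] L) (n : ℤ) :
    (a ^ n).restrictScalars F = a.restrictScalars F ^ n := by
  cases n with
  | ofNat n => rw [Int.ofNat_eq_natCast, zpow_natCast, zpow_natCast, AlgEquiv.restrictScalars_pow']
  | negSucc n =>
    rw [zpow_negSucc, zpow_negSucc, AlgEquiv.restrictScalars_inv', AlgEquiv.restrictScalars_pow']

omit [NumberField F] [NumberField K] [NumberField L] [NumberField E] [Algebra F K] [Algebra K L]
  [IsScalarTower F K L] [Algebra F E] [Algebra E L] [IsScalarTower F E L] [Field K] [Field E]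
  [Field F] [Algebra F L] in
/-- Products of powers of two commuting elements multiply by adding exponents. [folklore] -/
theorem Commute.zpow_mul_zpow_mul {G : Type*} [Group G] {x y : G} (hc : Commute x y)
    (i j k l : ℤ) : x ^ i * y ^ j * (x ^ k * y ^ l) = x ^ (i + k) * y ^ (j + l) := by
  have h : y ^ j * x ^ k = x ^ k * y ^ j := ((hc.zpow_right j).zpow_left k).eq.symm
  calc x ^ i * y ^ j * (x ^ k * y ^ l) = x ^ i * (y ^ j * x ^ k) * y ^ l := by group
    _ = x ^ i * (x ^ k * y ^ j) * y ^ l := by rw [h]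
    _ = x ^ (i + k) * y ^ (j + l) := by rw [zpow_add, zpow_add]; group

/-- **At a place inert in `K`, a place of `L` above a degree-`1` place of `E` is inert over `E`**
(`K/F` Galois quadratic, `[L:K] = 3`, `[L:E] = 2`, `L/F` Galois): `f(W|v) = 2 f(W|K) = f(W|E) ∣ 2`,
so `f(W|K) = 1` and `f(W|E) = f(W|v) = 2`. [folklore] -/
theorem HeightOneSpectrum.inertiaDeg_of_resolventInert_of_under_eq_one [IsGalois F L] [IsGalois F K]
    (hKL : Module.finrank K L = 3) (hEL : Module.finrank E L = 2)
    {v : HeightOneSpectrum (𝓞 F)} {V : HeightOneSpectrum (𝓞 K)} {W : HeightOneSpectrum (𝓞 L)}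
    (hV : V.asIdeal.under (𝓞 F) = v.asIdeal) (hinert : V.asIdeal.inertiaDeg (𝓞 F) = 2)
    (hWv : W.asIdeal.under (𝓞 F) = v.asIdeal)
    (hw : (W.asIdeal.under (𝓞 E)).inertiaDeg (𝓞 F) = 1) :
    W.asIdeal.inertiaDeg (𝓞 K) = 1 ∧ W.asIdeal.inertiaDeg (𝓞 E) = 2 ∧
      W.asIdeal.inertiaDeg (𝓞 F) = 2 := by
  haveI : IsGalois K L := IsGalois.tower_top_of_isGalois F K L
  haveI : IsGalois E L := IsGalois.tower_top_of_isGalois F E L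
  haveI : W.asIdeal.LiesOver (W.asIdeal.under (𝓞 K)) := ⟨rfl⟩
  haveI : W.asIdeal.LiesOver (W.asIdeal.under (𝓞 E)) := ⟨rfl⟩
  have hV'v : (W.asIdeal.under (𝓞 K)).under (𝓞 F) = v.asIdeal := by
    rw [Ideal.under_under, hWv]
  have hfV'' : (W.under (𝓞 K)).asIdeal.inertiaDeg (𝓞 F) = 2 := by
    rw [inertiaDeg_eq_inertiaDegIn_of_under_eq v (w := (W.under (𝓞 K))) hV'v,
      ← inertiaDeg_eq_inertiaDegIn_of_under_eq v hV, hinert]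
  have hfV' : (W.asIdeal.under (𝓞 K)).inertiaDeg (𝓞 F) = 2 := hfV''
  have hK : W.asIdeal.inertiaDeg (𝓞 K) ∣ 3 :=
    hKL ▸ HeightOneSpectrum.inertiaDeg_dvd_finrank (v := W.under (𝓞 K)) rfl
  have hE : W.asIdeal.inertiaDeg (𝓞 E) ∣ 2 :=
    hEL ▸ HeightOneSpectrum.inertiaDeg_dvd_finrank (v := W.under (𝓞 E)) rfl
  have htK : W.asIdeal.inertiaDeg (𝓞 F) =
      (W.asIdeal.under (𝓞 K)).inertiaDeg (𝓞 F) * W.asIdeal.inertiaDeg (𝓞 K) :=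
    Ideal.inertiaDeg_tower (W.asIdeal.under (𝓞 K)) W.asIdeal
  have htE : W.asIdeal.inertiaDeg (𝓞 F) =
      (W.asIdeal.under (𝓞 E)).inertiaDeg (𝓞 F) * W.asIdeal.inertiaDeg (𝓞 E) :=
    Ideal.inertiaDeg_tower (W.asIdeal.under (𝓞 E)) W.asIdeal
  rw [hfV'] at htK
  rw [hw, one_mul] at htE
  rcases (Nat.dvd_prime Nat.prime_three).1 hK with h1 | h3
  · refine ⟨h1, ?_, ?_⟩
    · rw [← htE, htK, h1]
    · rw [htK, h1]
  · exfalso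
    have : W.asIdeal.inertiaDeg (𝓞 E) = 6 := by rw [← htE, htK, h3]
    rw [this] at hE
    exact absurd hE (by norm_num)

/-- **If a place inert in `K` were totally split in `E`, `Gal(L/F)` would be abelian.**  In the
sextic diagram (`K/F` Galois quadratic, `[L:K] = 3`, `[L:E] = 2`, `L/F` Galois of degree `6`), at a
place `v` unramified in `L`, inert in `K`, all of whose places in `E` have degree `1`: every place
`W ∣ v` of `L` is inert over `W ∩ E` (`inertiaDeg_of_resolventInert_of_under_eq_one`), hence fixed
by `Gal(L/E) = ⟨s⟩`; for `1 ≠ a ∈ Gal(L/K)` both `s` and `a⁻¹ s a` lie in the decomposition group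
`D_W` of order `f(W|v) = 2`, so `a⁻¹ s a = s`; and `Gal(L/F) = ⟨s⟩ ⟨a⟩` is then abelian.  (For the
`S₃`-closure of a non-normal cubic this is the classical fact that primes inert in the quadratic
resolvent have splitting type `(1, 2)` in the cubic field.) [folklore] -/
theorem forall_mul_comm_of_resolventInert_of_forall_inertiaDeg_eq_one [IsGalois F L] [IsGalois F K]
    (hFL : Module.finrank F L = 6) (hKL : Module.finrank K L = 3) (hEL : Module.finrank E L = 2)
    {v : HeightOneSpectrum (𝓞 F)} {V : HeightOneSpectrum (𝓞 K)}
    (hV : V.asIdeal.under (𝓞 F) = v.asIdeal) (hinert : V.asIdeal.inertiaDeg (𝓞 F) = 2)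
    (hv : Algebra.IsUnramifiedIn (𝓞 L) v.asIdeal)
    (hEu : ∀ w : HeightOneSpectrum (𝓞 E), w.asIdeal.under (𝓞 F) = v.asIdeal →
      Algebra.IsUnramifiedIn (𝓞 L) w.asIdeal)
    (hall : ∀ w : HeightOneSpectrum (𝓞 E), w.asIdeal.under (𝓞 F) = v.asIdeal →
      w.asIdeal.inertiaDeg (𝓞 F) = 1) :
    ∀ g h : L ≃ₐ[F] L, g * h = h * g := by
  haveI : IsGalois K L := IsGalois.tower_top_of_isGalois F K L
  haveI : IsGalois E L := IsGalois.tower_top_of_isGalois F E L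
  -- every place of `L` above `v` is fixed by `Gal(L/E)`, and has `f(W|v) = 2`
  have hfix : ∀ W : HeightOneSpectrum (𝓞 L), W.asIdeal.under (𝓞 F) = v.asIdeal →
      (∀ s : L ≃ₐ[E] L, s • W = W) ∧ W.asIdeal.inertiaDeg (𝓞 F) = 2 := by
    intro W hWv
    have hw : (W.asIdeal.under (𝓞 E)).under (𝓞 F) = v.asIdeal := by rw [Ideal.under_under, hWv]
    obtain ⟨-, hfE, hfF⟩ := HeightOneSpectrum.inertiaDeg_of_resolventInert_of_under_eq_one
      hKL hEL hV hinert hWv (hall (W.under (𝓞 E)) hw)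
    refine ⟨fun s => HeightOneSpectrum.smul_eq_self_of_card_stabilizer_eq ?_ s, hfF⟩
    rw [HeightOneSpectrum.card_stabilizer_eq_inertiaDeg (F := E) (v := W.under (𝓞 E)) rfl
      (hEu (W.under (𝓞 E)) hw), hfE, hEL]
  -- a place above `V`, and generators `a` of `Gal(L/K)`, `s` of `Gal(L/E)`
  obtain ⟨W, hWV⟩ := exists_above (E := L) V
  have hWv : W.asIdeal.under (𝓞 F) = v.asIdeal := by
    rw [← Ideal.under_under (B := 𝓞 K) W.asIdeal, hWV, hV]
  have hcardA : Nat.card (L ≃ₐ[K] L) = 3 := (IsGalois.card_aut_eq_finrank K L).trans hKL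
  have hcardS : Nat.card (L ≃ₐ[E] L) = 2 := (IsGalois.card_aut_eq_finrank E L).trans hEL
  haveI : Nontrivial (L ≃ₐ[K] L) := Finite.one_lt_card_iff_nontrivial.1 (by rw [hcardA]; norm_num)
  haveI : Nontrivial (L ≃ₐ[E] L) := Finite.one_lt_card_iff_nontrivial.1 (by rw [hcardS]; norm_num)
  obtain ⟨a, ha⟩ := exists_ne (1 : L ≃ₐ[K] L)
  obtain ⟨s, hs⟩ := exists_ne (1 : L ≃ₐ[E] L)
  set S := s.restrictScalars F with hSdef
  set A := a.restrictScalars F with hAdef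
  have hS1 : S ≠ 1 := by
    intro h
    refine hs (algEquiv_eq_one_of_restrictScalars_eq (F := F) (a := (1 : L ≃ₐ[K] L)) hKL hEL ?_).1
    rw [← hSdef, h]
    exact AlgEquiv.ext fun _ => rfl
  -- `S` and `A⁻¹ S A` lie in the decomposition group `D_W`, of order `2`
  have h1 : S • W = W := by rw [hSdef, HeightOneSpectrum.restrictScalars_smul]; exact (hfix W hWv).1 s
  have hAWv : (A • W).asIdeal.under (𝓞 F) = v.asIdeal := by
    rw [← hWv]
    exact congrArg HeightOneSpectrum.asIdeal (HeightOneSpectrum.under_algEquiv_smul F L A W)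
  have h2 : S • (A • W) = A • W := by
    rw [hSdef, HeightOneSpectrum.restrictScalars_smul]; exact (hfix (A • W) hAWv).1 s
  have hmemS : S ∈ MulAction.stabilizer (L ≃ₐ[F] L) W := h1
  have hmemC : A⁻¹ * S * A ∈ MulAction.stabilizer (L ≃ₐ[F] L) W := by
    show (A⁻¹ * S * A) • W = W
    rw [mul_smul, mul_smul, h2, inv_smul_smul]
  have hcard2 : Nat.card (MulAction.stabilizer (L ≃ₐ[F] L) W) = 2 := by
    rw [HeightOneSpectrum.card_stabilizer_eq_inertiaDeg hWv hv, (hfix W hWv).2]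
  have hC1 : A⁻¹ * S * A ≠ 1 := by
    intro h
    apply hS1
    calc S = A * (A⁻¹ * S * A) * A⁻¹ := by group
      _ = 1 := by rw [h]; group
  -- a group of order `2` has a unique non-identity element
  obtain ⟨x, -, hx⟩ := (Nat.card_eq_two_iff' (1 : MulAction.stabilizer (L ≃ₐ[F] L) W)).1 hcard2
  have eS : (⟨S, hmemS⟩ : MulAction.stabilizer (L ≃ₐ[F] L) W) = x :=
    hx _ fun h => hS1 (congrArg Subtype.val h)
  have eC : (⟨A⁻¹ * S * A, hmemC⟩ : MulAction.stabilizer (L ≃ₐ[F] L) W) = x :=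
    hx _ fun h => hC1 (congrArg Subtype.val h)
  have hconj : A⁻¹ * S * A = S := congrArg Subtype.val (eC.trans eS.symm)
  have hc : Commute S A := by
    rw [commute_iff_eq]
    calc S * A = A * (A⁻¹ * S * A) := by group
      _ = A * S := by rw [hconj]
  -- `Gal(L/E) = ⟨s⟩`, `Gal(L/K) = ⟨a⟩`, `Gal(L/F) = ⟨s⟩ ⟨a⟩`
  haveI : Fact (Nat.Prime 2) := ⟨Nat.prime_two⟩
  haveI : Fact (Nat.Prime 3) := ⟨Nat.prime_three⟩
  have hzs : Subgroup.zpowers s = ⊤ := zpowers_eq_top_of_prime_card hcardS hs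
  have hza : Subgroup.zpowers a = ⊤ := zpowers_eq_top_of_prime_card hcardA ha
  haveI : FiniteDimensional F L := Module.Finite.of_restrictScalars_finite ℚ F L
  haveI : FiniteDimensional K L := Module.Finite.of_restrictScalars_finite ℚ K L
  haveI : FiniteDimensional E L := Module.Finite.of_restrictScalars_finite ℚ E L
  intro g h
  obtain ⟨s₁, a₁, rfl⟩ := exists_eq_restrictScalars_mul_restrictScalars hFL hKL hEL g
  obtain ⟨s₂, a₂, rfl⟩ := exists_eq_restrictScalars_mul_restrictScalars hFL hKL hEL h
  obtain ⟨m₁, rfl⟩ := Subgroup.mem_zpowers_iff.1 (hzs ▸ Subgroup.mem_top s₁ : s₁ ∈ Subgroup.zpowers s)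
  obtain ⟨m₂, rfl⟩ := Subgroup.mem_zpowers_iff.1 (hzs ▸ Subgroup.mem_top s₂ : s₂ ∈ Subgroup.zpowers s)
  obtain ⟨n₁, rfl⟩ := Subgroup.mem_zpowers_iff.1 (hza ▸ Subgroup.mem_top a₁ : a₁ ∈ Subgroup.zpowers a)
  obtain ⟨n₂, rfl⟩ := Subgroup.mem_zpowers_iff.1 (hza ▸ Subgroup.mem_top a₂ : a₂ ∈ Subgroup.zpowers a)
  simp only [AlgEquiv.restrictScalars_zpow', ← hSdef, ← hAdef]
  rw [hc.zpow_mul_zpow_mul, hc.zpow_mul_zpow_mul, add_comm m₁, add_comm n₁]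

/-- **A place inert in the quadratic resolvent has splitting type `(1, 2)` in the cubic field**
(`S₃` case: `Gal(L/F)` non-abelian; `v` unramified in `L` and in `E`): there are places `w₁, w₂`
of `E` above `v` with `f(w₁|v) = 1` and `f(w₂|v) = 2`.  From a place `W ∣ V` of `L`, `W ∩ E` has
degree `1` or `2` (`inertiaDeg_of_resolventInert`); the remaining degree among the places of `E`
above `v` (`∑_{w ∣ v} f(w|v) = 3`) is then `1` or `2`, the totally split configuration being
excluded by `forall_mul_comm_of_resolventInert_of_forall_inertiaDeg_eq_one`. [folklore] -/
theorem exists_inertiaDeg_eq_one_and_eq_two_of_resolventInert [IsGalois F L] [IsGalois F K]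
    (hG : ∃ g h : L ≃ₐ[F] L, g * h ≠ h * g)
    (hFL : Module.finrank F L = 6) (hKL : Module.finrank K L = 3) (hEL : Module.finrank E L = 2)
    (h3 : Module.finrank F E = 3)
    {v : HeightOneSpectrum (𝓞 F)} {V : HeightOneSpectrum (𝓞 K)}
    (hV : V.asIdeal.under (𝓞 F) = v.asIdeal) (hinert : V.asIdeal.inertiaDeg (𝓞 F) = 2)
    (hv : Algebra.IsUnramifiedIn (𝓞 L) v.asIdeal) (hvE : Algebra.IsUnramifiedIn (𝓞 E) v.asIdeal)
    (hEu : ∀ w : HeightOneSpectrum (𝓞 E), w.asIdeal.under (𝓞 F) = v.asIdeal →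
      Algebra.IsUnramifiedIn (𝓞 L) w.asIdeal) :
    ∃ w₁ w₂ : HeightOneSpectrum (𝓞 E), w₁.asIdeal.under (𝓞 F) = v.asIdeal ∧
      w₂.asIdeal.under (𝓞 F) = v.asIdeal ∧ w₁.asIdeal.inertiaDeg (𝓞 F) = 1 ∧
        w₂.asIdeal.inertiaDeg (𝓞 F) = 2 := by
  obtain ⟨g, h, hgh⟩ := hG
  haveI : Module.Finite (𝓞 F) (𝓞 E) := IsIntegralClosure.finite (𝓞 F) F E (𝓞 E)
  -- the places of `E` above `v` and their degree sum `3`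
  have hS := finite_setOf_asIdeal_under_eq (E := E) v
  have hsum := finsum_inertiaDeg_eq_finrank (E := E) v hvE
  rw [finsum_mem_eq_finite_toFinset_sum _ hS, h3] at hsum
  have hpos : ∀ w ∈ hS.toFinset, 0 < w.asIdeal.inertiaDeg (𝓞 F) := fun w _ => by
    haveI := w.isPrime
    exact w.asIdeal.inertiaDeg_pos (𝓞 F)
  -- a place of `L` above `V` and its trace `w₀` on `E`
  obtain ⟨W, hWV⟩ := exists_above (E := L) V
  have hWv : W.asIdeal.under (𝓞 F) = v.asIdeal := by
    rw [← Ideal.under_under (B := 𝓞 K) W.asIdeal, hWV, hV]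
  set w₀ : HeightOneSpectrum (𝓞 E) := W.under (𝓞 E) with hw₀def
  have hw₀ : w₀.asIdeal.under (𝓞 F) = v.asIdeal := by
    show (W.asIdeal.under (𝓞 E)).under (𝓞 F) = v.asIdeal
    rw [Ideal.under_under, hWv]
  have hw₀mem : w₀ ∈ hS.toFinset := hS.mem_toFinset.2 hw₀
  obtain ⟨-, -, hcase⟩ :=
    HeightOneSpectrum.inertiaDeg_of_resolventInert ⟨g, h, hgh⟩ hFL hKL hEL hV hWV hinert hv
  rcases hcase with ⟨-, h2⟩ | ⟨-, h1⟩
  · -- `f(w₀|v) = 2`: the remaining places have total degree `1`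
    have h2' : w₀.asIdeal.inertiaDeg (𝓞 F) = 2 := h2
    have hrest : ∑ w ∈ hS.toFinset.erase w₀, w.asIdeal.inertiaDeg (𝓞 F) = 1 := by
      have := Finset.sum_erase_add _ (fun w : HeightOneSpectrum (𝓞 E) => w.asIdeal.inertiaDeg (𝓞 F))
        hw₀mem
      rw [hsum, h2'] at this
      omega
    obtain ⟨w₁, hw₁mem, hw₁ne⟩ := Finset.exists_ne_zero_of_sum_ne_zero
      (s := hS.toFinset.erase w₀) (f := fun w : HeightOneSpectrum (𝓞 E) => w.asIdeal.inertiaDeg (𝓞 F))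
      (by rw [hrest]; exact one_ne_zero)
    have hw₁le : w₁.asIdeal.inertiaDeg (𝓞 F) ≤ 1 :=
      hrest ▸ Finset.single_le_sum (f := fun w : HeightOneSpectrum (𝓞 E) => w.asIdeal.inertiaDeg (𝓞 F))
        (fun w _ => Nat.zero_le _) hw₁mem
    refine ⟨w₁, w₀, hS.mem_toFinset.1 (Finset.mem_of_mem_erase hw₁mem), hw₀, ?_, h2'⟩
    have : w₁.asIdeal.inertiaDeg (𝓞 F) ≠ 0 := hw₁ne
    omega
  · -- `f(w₀|v) = 1`: some place has degree `2`, else all have degree `1`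
    have h1' : w₀.asIdeal.inertiaDeg (𝓞 F) = 1 := h1
    by_contra hno
    push Not at hno
    have hall : ∀ w : HeightOneSpectrum (𝓞 E), w.asIdeal.under (𝓞 F) = v.asIdeal →
        w.asIdeal.inertiaDeg (𝓞 F) = 1 := by
      intro w hw
      have hwmem : w ∈ hS.toFinset := hS.mem_toFinset.2 hw
      have hne2 : w.asIdeal.inertiaDeg (𝓞 F) ≠ 2 := hno w₀ w hw₀ hw h1'
      have hle : w.asIdeal.inertiaDeg (𝓞 F) ≤ 3 :=
        hsum ▸ Finset.single_le_sum (f := fun w : HeightOneSpectrum (𝓞 E) => w.asIdeal.inertiaDeg (𝓞 F))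
          (fun w _ => Nat.zero_le _) hwmem
      have hposw := hpos w hwmem
      by_contra hne1
      have hw3 : w.asIdeal.inertiaDeg (𝓞 F) = 3 := by omega
      have hne : w ≠ w₀ := by
        rintro rfl
        rw [h1'] at hw3
        exact absurd hw3 (by norm_num)
      have hpair : w.asIdeal.inertiaDeg (𝓞 F) + w₀.asIdeal.inertiaDeg (𝓞 F) ≤ 3 := by
        have hsub : ({w, w₀} : Finset (HeightOneSpectrum (𝓞 E))) ⊆ hS.toFinset :=
          Finset.insert_subset_iff.2 ⟨hwmem, Finset.singleton_subset_iff.2 hw₀mem⟩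
        have := Finset.sum_le_sum_of_subset_of_nonneg
          (f := fun w : HeightOneSpectrum (𝓞 E) => w.asIdeal.inertiaDeg (𝓞 F)) hsub
          (fun _ _ _ => Nat.zero_le _)
        rwa [Finset.sum_pair hne, hsum] at this
      omega
    exact hgh (forall_mul_comm_of_resolventInert_of_forall_inertiaDeg_eq_one hFL hKL hEL hV hinert
      hv hEu hall g h)

end Inert

/-! ### The sign-blind half of the fact, stated over `E/F` alone -/

section NotNormal

/-- **Non-normal cubic automorphic induction away from the places of splitting type `(1, 2)`.**
Let `E/F` be a cubic extension of number fields which is NOT normal, and `θ` a Hecke character of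
`E` such that at infinitely many places `v` of `F` of splitting type other than `(1, 2)` in `E` two
places of `E` above `v` carry different values of `θ`.  Granting Arthur–Clozel's cyclic automorphic
induction of prime degree with its cuspidality clause (`automorphicInduction_cyclic_cuspidal`) and
cyclic descent of prime degree (`cuspidal_descent_cyclic`), there is a CUSPIDAL automorphic
representation `π` of `GL₃(𝔸_F)` such that `det(X - t_{π,v}) = ∏_{w ∣ v} (X^{f(w|v)} - θ(ϖ_w))`
— the local identity of `automorphicInduction_unitaryCharacter_cubic` — at almost every place
`v` of `F` whose splitting type in `E` is not `(1, 2)` (i.e. `v` totally split or inert in `E`;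
density `1/2`).  Proof: with `α` a primitive element of `E/F`, the splitting field `L` of
`minpoly F α` is the Galois closure, of degree `6` with non-abelian group
(`finrank_splittingField_eq_six`, `exists_mul_ne_of_not_normal`), `E ↪ L` with `[L:E] = 2`, and
the fixed field `K` of a subgroup of order `3` is the quadratic resolvent
(`exists_intermediateField_resolvent`); at almost every `v`, "splitting type not `(1, 2)`" means
"`v` splits in `K`" (`exists_inertiaDeg_eq_one_and_eq_two_of_resolventInert`), and
`exists_cuspidal_cubic_resolventSplit_of_frequently` (file `…ResolventDescent`) applies.  The
places of type `(1, 2)` (the transpositions of `S₃`, density `1/2`) are exactly where the cyclic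
theory determines only `t_{π,v}²` (`exists_cuspidal_cubic_resolvent`): there the identity is the
theorem of Jacquet–Piatetski-Shapiro–Shalika (converse theorem for `GL(3)`), not available in the
tree. [cite: ArthurClozelAMS120, Ch. 3 Thm. 6.2, Lemma 6.4 and Thm. 4.2 (d)]
[cite: Gelbart1997, Thm. 5.3.1 and Remark 5.3.1 (a), (e)]
[cite: JacquetPiatetskishapiroShalika1979II, §§13–14] -/
theorem exists_cuspidal_cubic_of_not_normal
    (hAIc : automorphicInduction_cyclic_cuspidal) (hD : cuspidal_descent_cyclic)
    {F E : Type} [Field F] [NumberField F] [Field E] [NumberField E] [Algebra F E]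
    (h3 : Module.finrank F E = 3) (hE : ¬ Normal F E)
    (θ : GaloisRepresentations.HeckeCharacter E)
    (hθ : ∃ᶠ v : HeightOneSpectrum (𝓞 F) in cofinite,
      (¬ ∃ w₁ w₂ : HeightOneSpectrum (𝓞 E), w₁.asIdeal.under (𝓞 F) = v.asIdeal ∧
          w₂.asIdeal.under (𝓞 F) = v.asIdeal ∧ w₁.asIdeal.inertiaDeg (𝓞 F) = 1 ∧
            w₂.asIdeal.inertiaDeg (𝓞 F) = 2) ∧
        ∃ w w' : HeightOneSpectrum (𝓞 E), w.asIdeal.under (𝓞 F) = v.asIdeal ∧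
          w'.asIdeal.under (𝓞 F) = v.asIdeal ∧ θ.valueAtUniformizer w ≠ θ.valueAtUniformizer w')
    (hF : isCompact_glFiniteIntegralLevel 3 F) :
    ∃ π : CuspidalAutomorphicRepData 3 F hF,
      ∀ᶠ v : HeightOneSpectrum (𝓞 F) in cofinite,
        (¬ ∃ w₁ w₂ : HeightOneSpectrum (𝓞 E), w₁.asIdeal.under (𝓞 F) = v.asIdeal ∧
            w₂.asIdeal.under (𝓞 F) = v.asIdeal ∧ w₁.asIdeal.inertiaDeg (𝓞 F) = 1 ∧
              w₂.asIdeal.inertiaDeg (𝓞 F) = 2) →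
          ∃ α : Multiset ℂ, π.1.HasSatakeParamAt v α ∧
            satakePolynomial α =
              ∏ᶠ w ∈ {w : HeightOneSpectrum (𝓞 E) | w.under (𝓞 F) = v},
                (X ^ w.asIdeal.inertiaDeg (𝓞 F) - C (θ.valueAtUniformizer w)) := by
  -- the Galois closure `L` of `E/F`
  obtain ⟨α, hα⟩ := Field.exists_primitive_element F E
  obtain ⟨φ⟩ := nonempty_algHom_splittingField_of_adjoin_eq_top hα
  letI : Algebra E (minpoly F α).SplittingField := φ.toRingHom.toAlgebra
  haveI : IsScalarTower F E (minpoly F α).SplittingField :=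
    IsScalarTower.of_algebraMap_eq fun x => (φ.commutes x).symm
  have hsep : (minpoly F α).Separable := Algebra.IsSeparable.isSeparable F α
  haveI : IsGalois F (minpoly F α).SplittingField := IsGalois.of_separable_splitting_field hsep
  haveI : NumberField (minpoly F α).SplittingField :=
    NumberField.of_module_finite F (minpoly F α).SplittingField
  have h6 : Module.finrank F (minpoly F α).SplittingField = 6 := finrank_splittingField_eq_six h3 hE hα
  have hG := exists_mul_ne_of_not_normal h3 hE hα
  have hEL : Module.finrank E (minpoly F α).SplittingField = 2 := by
    have := Module.finrank_mul_finrank F E (minpoly F α).SplittingField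
    rw [h3, h6] at this
    omega
  haveI : IsGalois E (minpoly F α).SplittingField :=
    IsGalois.tower_top_of_isGalois F E (minpoly F α).SplittingField
  -- the quadratic resolvent `K`
  obtain ⟨K, hFK, hKL, hKgal⟩ :=
    exists_intermediateField_resolvent (F := F) (L := (minpoly F α).SplittingField) h6
  haveI := hKgal
  -- unramifiedness, almost everywhere
  have hur : ∀ᶠ v : HeightOneSpectrum (𝓞 F) in cofinite,
      Algebra.IsUnramifiedIn (𝓞 (minpoly F α).SplittingField) v.asIdeal ∧
        Algebra.IsUnramifiedIn (𝓞 E) v.asIdeal ∧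
          ∀ w : HeightOneSpectrum (𝓞 E), w.asIdeal.under (𝓞 F) = v.asIdeal →
            Algebra.IsUnramifiedIn (𝓞 (minpoly F α).SplittingField) w.asIdeal :=
    (Filter.eventually_cofinite.2
      (GaloisRepresentations.finite_setOf_not_isUnramifiedIn F (minpoly F α).SplittingField)).and
      ((Filter.eventually_cofinite.2 (GaloisRepresentations.finite_setOf_not_isUnramifiedIn F E)).and
        (eventually_forall_under_eq (F := F) (Filter.eventually_cofinite.2
          (GaloisRepresentations.finite_setOf_not_isUnramifiedIn E (minpoly F α).SplittingField))))
  -- "splitting type not (1,2)" means "split in `K`", almost everywhere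
  have key : ∀ v : HeightOneSpectrum (𝓞 F),
      (Algebra.IsUnramifiedIn (𝓞 (minpoly F α).SplittingField) v.asIdeal ∧
        Algebra.IsUnramifiedIn (𝓞 E) v.asIdeal ∧
          ∀ w : HeightOneSpectrum (𝓞 E), w.asIdeal.under (𝓞 F) = v.asIdeal →
            Algebra.IsUnramifiedIn (𝓞 (minpoly F α).SplittingField) w.asIdeal) →
      (¬ ∃ w₁ w₂ : HeightOneSpectrum (𝓞 E), w₁.asIdeal.under (𝓞 F) = v.asIdeal ∧
          w₂.asIdeal.under (𝓞 F) = v.asIdeal ∧ w₁.asIdeal.inertiaDeg (𝓞 F) = 1 ∧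
            w₂.asIdeal.inertiaDeg (𝓞 F) = 2) →
        ∃ V : HeightOneSpectrum (𝓞 K), V.asIdeal.under (𝓞 F) = v.asIdeal ∧
          V.asIdeal.inertiaDeg (𝓞 F) = 1 := by
    rintro v ⟨hvL, hvE, hEu⟩ hnot
    obtain ⟨V, hV⟩ := exists_above (E := K) v
    rcases inertiaDeg_eq_one_or_two_of_finrank_eq_two hFK v V hV with h1 | h2
    · exact ⟨V, hV, h1⟩
    · exact absurd (exists_inertiaDeg_eq_one_and_eq_two_of_resolventInert hG h6 hKL hEL h3 hV h2
        hvL hvE hEu) hnot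
  have hθ' : ∃ᶠ v : HeightOneSpectrum (𝓞 F) in cofinite,
      (∃ V : HeightOneSpectrum (𝓞 K), V.asIdeal.under (𝓞 F) = v.asIdeal ∧
          V.asIdeal.inertiaDeg (𝓞 F) = 1) ∧
        ∃ w w' : HeightOneSpectrum (𝓞 E), w.asIdeal.under (𝓞 F) = v.asIdeal ∧
          w'.asIdeal.under (𝓞 F) = v.asIdeal ∧
            θ.valueAtUniformizer w ≠ θ.valueAtUniformizer w' :=
    (hθ.and_eventually hur).mono fun v ⟨⟨hnot, hw⟩, hv⟩ => ⟨key v hv hnot, hw⟩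
  obtain ⟨π, hπ⟩ := exists_cuspidal_cubic_resolventSplit_of_frequently hAIc hD hFK hKL hEL θ hθ' hF
  refine ⟨π, ?_⟩
  filter_upwards [hπ, hur] with v hv hvu hnot
  exact hv (key v hvu hnot)

end NotNormal

end Literature.NumberTheory.Automorphic

end
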